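import Mathlib
import Literature.AlgebraicGeometry.ShimuraVarieties.UnitaryBallDiscontinuity
import Literature.AlgebraicGeometry.ShimuraVarieties.UnitaryBallFormPullback
import Literature.Geometry.ComplexHyperbolic.UnitBallMeasure
import HarnessLib

/-!
# Unfolding integrals over sheets of the uniformization `𝔹² → Γ\𝔹²`

For a unitary ball-quotient datum `D : UnitaryBallUniformisationDatum 2 X₂` with Sylvester frame `𝔣`
(so `Γ` acts on the ball `𝔹²` through `D.ballRep 𝔣 : Γ →* U(2,1)`, freely —
`UnitaryBallUniformisationDatum.eq_one_of_smul_eq`) and a Hodge model `A` of `X₂` (so that the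
uniformization `ψ = D.modelUnif A 𝔣 : ℂ² → X^an` has the `Γ`-orbits as fibres,
`modelUnif_eq_iff`), we PROVE the elementary **unfolding identity** underlying the comparison of
integrals over `X^an` with integrals over a fundamental domain in the ball:

* `setIntegral_sheet_eq_setIntegral_fundamentalDomain` — let `Δ ≤ U(2,1)` be the image of `Γ`,
  `𝓕 ⊆ 𝔹²` a measurable fundamental domain for `Δ` with respect to Lebesgue measure
  `ballVolume`, `V ⊆ 𝔹²` a measurable relatively compact **sheet** (a set on which
  `z ↦ ψ z` is injective), `k : 𝔹² → ℂ` continuous and `Δ`-invariant, and `h : 𝔹² → ℂ`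
  continuous and **Jacobian-twisted**: `h z = det_ℝ J(δ, z) · h (δ z)`. Then
  `∫_V k h dλ = ∫_𝓕 𝟙_{Δ V} k h dλ`, where `Δ V = {z | ∃ δ, δ z ∈ V}` is the saturation.

The proof is the change of variables `z ↦ δ z` on `ℂ²` (Mathlib's
`integral_image_eq_integral_abs_det_fderiv_smul`, with `|det_ℝ J(δ,z)| = |det_ℂ Jac(δ,z)|² > 0`),
the decomposition `λ = Σ_δ λ|_{δ 𝓕}` (`IsFundamentalDomain.integral_eq_tsum_of_ac`, which needs no
invariance of the measure), and the fact that a sheet meets each orbit at most once (freeness of the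
action + injectivity of `ψ` on `V`). Also: `Γ` is countable (`countable_Γ`), the real Jacobian
determinant `det_ℝ J(g, z) = |det Jac(g, z)|²` (`det_jacCLM`), and the change-of-variables formulas
`setIntegral_smul_eq` / `setLIntegral_smul_eq` for `z ↦ g z` on the ball.

References: the unfolding step is the standard one of the Rankin–Selberg / Petersson inner product
computations, e.g. [Borel1997, §5.14–5.15] (integration over `Γ\G` vs. a fundamental domain) and
[Rudin1980, §1.4, Thm 2.2.6] (change of variables for automorphisms of the ball).

## Provenance

Written under the LEAN-IN-TREE rule for the pub-hodgecm formalisation cell (model-construction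
sub-cell, seat mc-unitary-3 gen 2, node D2-chart). Everything here is kernel-checked; nothing is a
claim of the manuscripts adjudicated by that cell.
-/

set_option autoImplicit false

noncomputable section

open MeasureTheory MeasureTheory.Measure Set Filter Function Complex
open scoped Topology ENNReal Manifold Pointwise
open Literature.Geometry.ComplexHyperbolic
open Literature.Geometry.ComplexHyperbolic.BallModel

namespace Literature.AlgebraicGeometry.ShimuraVarieties

open _root_.MeasureTheory _root_.MeasureTheory.Measure _root_.Set

/-! ### The real Jacobian determinant of `z ↦ g z` -/

namespace UnitaryBallUniformisationDatum

/-- **`det_ℝ J(g, z) = |det Jac(g, z)|²`**: the determinant of the Jacobian of `z ↦ g z` viewed as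
a real-linear map of `ℂ² = ℝ⁴` is the square of the modulus of the complex Jacobian determinant.
[folklore] -/
theorem det_jacCLM (g : U21) (z : Ball) :
    (jacCLM g z).det = Complex.normSq (Jac g z).det := by
  rw [jacCLM, ContinuousLinearMap.det, ContinuousLinearMap.coe_restrictScalars,
    LinearMap.det_restrictScalars, Algebra.norm_complex_apply]
  congr 1
  change LinearMap.det (Matrix.mulVecLin (Jac g z)) = _
  rw [← Matrix.toLin'_apply', LinearMap.det_toLin']

/-- The real Jacobian determinant of `z ↦ g z` is positive. [folklore] -/
theorem det_jacCLM_pos (g : U21) (z : Ball) : 0 < (jacCLM g z).det := by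
  rw [det_jacCLM]
  exact Complex.normSq_pos.2 (det_Jac_ne_zero g z)

/-- `|det_ℝ J(g, z)| = det_ℝ J(g, z)`. [folklore] -/
theorem abs_det_jacCLM (g : U21) (z : Ball) : |(jacCLM g z).det| = (jacCLM g z).det :=
  abs_of_pos (det_jacCLM_pos g z)

end UnitaryBallUniformisationDatum

/-! ### Change of variables `z ↦ g z` on the ball -/

namespace BallUnfolding

open UnitaryBallUniformisationDatum

/-- The Jacobian of `actVec g` as a function on `ℂ²` (junk `0` off the ball). [folklore] -/
def jacExt (g : U21) (w : Fin 2 → ℂ) : (Fin 2 → ℂ) →L[ℝ] (Fin 2 → ℂ) :=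
  if hw : nsq w < 1 then jacCLM g ⟨w, hw⟩ else 0

/-- On the ball `jacExt` is `jacCLM`. [folklore] -/
theorem jacExt_coe (g : U21) (z : Ball) : jacExt g z.1 = jacCLM g z := by
  simp only [jacExt, dif_pos z.2, Subtype.coe_eta]

/-- `actVec g` has derivative `jacExt g w` within any subset of the ball. [folklore] -/
theorem hasFDerivWithinAt_actVec (g : U21) {S : Set (Fin 2 → ℂ)} (hS : S ⊆ {w | nsq w < 1})
    (w : Fin 2 → ℂ) (hw : w ∈ S) : HasFDerivWithinAt (actVec g) (jacExt g w) S w := by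
  have hw' : nsq w < 1 := hS hw
  let zB : Ball := ⟨w, hw'⟩
  have h := ((BallModel.hasFDerivAt_actVec g zB).restrictScalars ℝ).hasFDerivWithinAt (s := S)
  rw [jacExt, dif_pos hw']
  exact h

/-- `actVec g` is injective on the ball. [folklore] -/
theorem injOn_actVec (g : U21) : InjOn (actVec g) {w : Fin 2 → ℂ | nsq w < 1} := by
  intro w hw w' hw' h
  obtain ⟨zB, rfl⟩ : ∃ z : Ball, z.1 = w := ⟨⟨w, hw⟩, rfl⟩
  obtain ⟨zB', rfl⟩ : ∃ z : Ball, z.1 = w' := ⟨⟨w', hw'⟩, rfl⟩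
  have h1 : actVec g zB.1 = actVec g zB'.1 := h
  rw [actVec_eq, actVec_eq] at h1
  have h2 : g • zB = g • zB' := Subtype.ext h1
  rw [MulAction.injective g h2]

/-- The image of `S ⊆ 𝔹²` under `z ↦ g z`, read in `ℂ²`, is `actVec g '' S`. [folklore] -/
theorem image_coe_smul (g : U21) (S : Set Ball) :
    (fun z : Ball ↦ (z.1 : Fin 2 → ℂ)) '' (g • S) = actVec g '' ((fun z : Ball ↦ (z.1 : Fin 2 → ℂ)) '' S) := by
  rw [← image_smul, image_image, image_image]
  exact image_congr fun z _ ↦ (actVec_eq g z).symm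

/-- `setIntegral_ballVolume` with the inclusion written as a lambda. [folklore] -/
theorem setIntegral_ballVolume' {F : Type*} [NormedAddCommGroup F] [NormedSpace ℝ F]
    (f : (Fin 2 → ℂ) → F) (S : Set Ball) :
    ∫ z in S, f z.1 ∂ballVolume = ∫ w in (fun z : Ball ↦ (z.1 : Fin 2 → ℂ)) '' S, f w ∂volume :=
  setIntegral_ballVolume f S

/-- `setLIntegral_ballVolume` with the inclusion written as a lambda. [folklore] -/
theorem setLIntegral_ballVolume' (f : (Fin 2 → ℂ) → ℝ≥0∞) (S : Set Ball) :
    ∫⁻ z in S, f z.1 ∂ballVolume = ∫⁻ w in (fun z : Ball ↦ (z.1 : Fin 2 → ℂ)) '' S, f w ∂volume :=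
  setLIntegral_ballVolume f S

/-- **Change of variables on the ball**: `∫_{g S} G dλ = ∫_S det_ℝ J(g,z) · G(g z) dλ(z)` for
measurable `S ⊆ 𝔹²` and any `G : 𝔹² → F`. [cite: Rudin1980, §1.4, Thm 2.2.6] -/
theorem setIntegral_smul_eq {F : Type*} [NormedAddCommGroup F] [NormedSpace ℝ F]
    (g : U21) {S : Set Ball} (hS : MeasurableSet S) (G : Ball → F) :
    ∫ z in g • S, G z ∂ballVolume = ∫ z in S, (jacCLM g z).det • G (g • z) ∂ballVolume := by
  obtain ⟨G', hG'⟩ := exists_eq_comp_coe G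
  have hSm : MeasurableSet ((fun z : Ball ↦ (z.1 : Fin 2 → ℂ)) '' S) := measurableSet_image_coe hS
  have hSB : (fun z : Ball ↦ (z.1 : Fin 2 → ℂ)) '' S ⊆ {w | nsq w < 1} := image_coe_subset S
  have lhs : ∫ z in g • S, G z ∂ballVolume =
      ∫ w in actVec g '' ((fun z : Ball ↦ (z.1 : Fin 2 → ℂ)) '' S), G' w ∂volume := by
    rw [hG']
    rw [setIntegral_ballVolume' (fun w ↦ G' w) (g • S), image_coe_smul]
  rw [lhs, integral_image_eq_integral_abs_det_fderiv_smul volume hSm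
    (hasFDerivWithinAt_actVec g hSB) ((injOn_actVec g).mono hSB)]
  rw [hG']
  rw [← setIntegral_ballVolume' (fun w ↦ |(jacExt g w).det| • G' (actVec g w)) S]
  refine setIntegral_congr_fun hS fun z _ ↦ ?_
  simp only [jacExt_coe, abs_det_jacCLM, actVec_eq]

/-- **Change of variables on the ball, `∫⁻` version**:
`∫⁻_{g S} G dλ = ∫⁻_S det_ℝ J(g,z) · G(g z) dλ(z)`. [cite: Rudin1980, §1.4, Thm 2.2.6] -/
theorem setLIntegral_smul_eq (g : U21) {S : Set Ball} (hS : MeasurableSet S) (G : Ball → ℝ≥0∞) :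
    ∫⁻ z in g • S, G z ∂ballVolume =
      ∫⁻ z in S, ENNReal.ofReal (jacCLM g z).det * G (g • z) ∂ballVolume := by
  obtain ⟨G', hG'⟩ := exists_eq_comp_coe G
  have hSm : MeasurableSet ((fun z : Ball ↦ (z.1 : Fin 2 → ℂ)) '' S) := measurableSet_image_coe hS
  have hSB : (fun z : Ball ↦ (z.1 : Fin 2 → ℂ)) '' S ⊆ {w | nsq w < 1} := image_coe_subset S
  have lhs : ∫⁻ z in g • S, G z ∂ballVolume =
      ∫⁻ w in actVec g '' ((fun z : Ball ↦ (z.1 : Fin 2 → ℂ)) '' S), G' w ∂volume := by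
    rw [hG']
    rw [setLIntegral_ballVolume' (fun w ↦ G' w) (g • S), image_coe_smul]
  rw [lhs, lintegral_image_eq_lintegral_abs_det_fderiv_mul volume hSm
    (hasFDerivWithinAt_actVec g hSB) ((injOn_actVec g).mono hSB)]
  rw [hG']
  rw [← setLIntegral_ballVolume' (fun w ↦ ENNReal.ofReal |(jacExt g w).det| * G' (actVec g w)) S]
  refine setLIntegral_congr_fun hS fun z _ ↦ ?_
  simp only [jacExt_coe, abs_det_jacCLM, actVec_eq]

end BallUnfolding

/-! ### Countability of `Γ` -/

namespace UnitaryBallUniformisationDatum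

variable {X₂ : Motives.SchemeOver ℂ} (D : UnitaryBallUniformisationDatum 2 X₂)

/-- **`Γ` is countable** (it is discrete: only finitely many `γ` have `ballRep γ` with entries of
norm `≤ R`, for every `R`). [cite: Borel1969, Prop. 7.13] -/
theorem countable_Γ (𝔣 : D.SylvesterFrame) : Countable D.Γ := by
  have hcover : (univ : Set D.Γ) ⊆ ⋃ n : ℕ, {γ : D.Γ | ∀ i j, ‖mat (D.ballRep 𝔣 γ) i j‖ ≤ (n : ℝ)} := by
    intro γ _
    obtain ⟨n, hn⟩ := exists_nat_ge (∑ i, ∑ j, ‖mat (D.ballRep 𝔣 γ) i j‖)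
    refine mem_iUnion.2 ⟨n, fun i j ↦ le_trans ?_ hn⟩
    exact (Finset.single_le_sum (f := fun j ↦ ‖mat (D.ballRep 𝔣 γ) i j‖)
      (fun _ _ ↦ norm_nonneg _) (Finset.mem_univ j)).trans
      (Finset.single_le_sum (f := fun i ↦ ∑ j, ‖mat (D.ballRep 𝔣 γ) i j‖)
        (fun _ _ ↦ Finset.sum_nonneg fun _ _ ↦ norm_nonneg _) (Finset.mem_univ i))
  have hc : (univ : Set D.Γ).Countable :=
    (Set.countable_iUnion fun n : ℕ ↦ (D.finite_setOf_norm_entry_le 𝔣 (n : ℝ)).countable).mono hcover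
  exact countable_univ_iff.1 hc

end UnitaryBallUniformisationDatum

/-! ### Decomposing a measure along a measurable fundamental domain (no invariance needed) -/

namespace BallUnfolding

/-- For a MEASURABLE fundamental domain `s` of a countable group acting measurably, the measure is
the sum of its restrictions to the translates `g • s` — no invariance of the measure is needed
(Mathlib's `IsFundamentalDomain.sum_restrict_of_ac` asks for an invariant measure only to know that
the translates are null-measurable). [folklore] -/
theorem sum_restrict_smul_eq {G α : Type*} [Group G] [MulAction G α] [MeasurableSpace α]
    [MeasurableConstSMul G α] [Countable G] {s : Set α} {μ : Measure α}
    (h : IsFundamentalDomain G s μ) (hs : MeasurableSet s) :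
    (Measure.sum fun g : G ↦ μ.restrict (g • s)) = μ := by
  rw [← restrict_iUnion_ae (h.aedisjoint.mono fun i j hij ↦ hij)
      fun g ↦ (hs.const_smul g).nullMeasurableSet,
    restrict_congr_set h.iUnion_smul_ae_eq, restrict_univ]

/-- `∫⁻ f dμ = Σ_g ∫⁻_{g s} f dμ` for a measurable fundamental domain (no invariance needed).
[folklore] -/
theorem lintegral_eq_tsum_smul {G α : Type*} [Group G] [MulAction G α] [MeasurableSpace α]
    [MeasurableConstSMul G α] [Countable G] {s : Set α} {μ : Measure α}
    (h : IsFundamentalDomain G s μ) (hs : MeasurableSet s) (f : α → ℝ≥0∞) :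
    ∫⁻ x, f x ∂μ = ∑' g : G, ∫⁻ x in g • s, f x ∂μ := by
  rw [← lintegral_sum_measure, sum_restrict_smul_eq h hs]

/-- `∫ f dμ = Σ_g ∫_{g s} f dμ` for a measurable fundamental domain and integrable `f`
(no invariance needed). [folklore] -/
theorem integral_eq_tsum_smul {G α : Type*} [Group G] [MulAction G α] [MeasurableSpace α]
    [MeasurableConstSMul G α] [Countable G] {s : Set α} {μ : Measure α}
    {F : Type*} [NormedAddCommGroup F] [NormedSpace ℝ F]
    (h : IsFundamentalDomain G s μ) (hs : MeasurableSet s) (f : α → F) (hf : Integrable f μ) :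
    ∫ x, f x ∂μ = ∑' g : G, ∫ x in g • s, f x ∂μ := by
  rw [← integral_sum_measure, sum_restrict_smul_eq h hs]
  rw [sum_restrict_smul_eq h hs]
  exact hf

end BallUnfolding

/-! ### The unfolding identity -/

namespace BallUnfolding

open UnitaryBallUniformisationDatum
open Literature.AlgebraicGeometry.HodgeTheory (HodgeModel)

variable {X₂ : Motives.SchemeOver ℂ} (D : UnitaryBallUniformisationDatum 2 X₂) (A : HodgeModel 2 X₂)
  (𝔣 : D.SylvesterFrame)

/-- The **saturation** `Δ V = {z | ∃ δ ∈ Δ, δ z ∈ V}` of a subset of the ball under a subgroup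
`Δ ≤ U(2,1)`. [folklore] -/
def satur (Δ : Subgroup U21) (V : Set Ball) : Set Ball := {z | ∃ δ : Δ, δ • z ∈ V}

/-- The saturation is the union of the translates `δ⁻¹ V`. [folklore] -/
theorem satur_eq_iUnion (Δ : Subgroup U21) (V : Set Ball) :
    satur Δ V = ⋃ δ : Δ, (fun z ↦ δ • z) ⁻¹' V := by
  ext z; simp [satur]

/-- The saturation of a measurable set under a countable subgroup is measurable. [folklore] -/
theorem measurableSet_satur (Δ : Subgroup U21) [Countable Δ] {V : Set Ball} (hV : MeasurableSet V) :
    MeasurableSet (satur Δ V) := by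
  rw [satur_eq_iUnion]
  exact MeasurableSet.iUnion fun δ ↦ (measurable_const_smul (δ : U21)) hV

/-- A subgroup `Δ ≤ U(2,1)` **is the image of `Γ`**: its elements are exactly the `ballRep γ`.
(Both `(D.ballRep 𝔣).range` and `(⊤ : Subgroup Γ).map (D.ballRep 𝔣)` satisfy this.) [folklore] -/
def IsImageOfΓ (Δ : Subgroup U21) : Prop := ∀ u : U21, u ∈ Δ ↔ ∃ γ : D.Γ, D.ballRep 𝔣 γ = u

/-- `(D.ballRep 𝔣).range` is the image of `Γ`. [folklore] -/
theorem isImageOfΓ_range : IsImageOfΓ D 𝔣 (D.ballRep 𝔣).range := fun _ ↦ MonoidHom.mem_range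

/-- `(⊤ : Subgroup Γ).map (D.ballRep 𝔣)` is the image of `Γ`. [folklore] -/
theorem isImageOfΓ_map_top : IsImageOfΓ D 𝔣 ((⊤ : Subgroup D.Γ).map (D.ballRep 𝔣)) := fun u ↦ by
  rw [← MonoidHom.range_eq_map]; exact MonoidHom.mem_range

variable {D 𝔣}

/-- The image of `Γ` is countable. [folklore] -/
theorem IsImageOfΓ.countable {Δ : Subgroup U21} (hΔ : IsImageOfΓ D 𝔣 Δ) : Countable Δ := by
  haveI := D.countable_Γ 𝔣
  have h : (Δ : Set U21) = Set.range (D.ballRep 𝔣) := by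
    ext u; simpa using hΔ u
  have hc : (Δ : Set U21).Countable := by rw [h]; exact Set.countable_range _
  exact hc.to_subtype

/-- **Freeness** of the image of `Γ`: `δ z = z ⇒ δ = 1`. [cite: BergeronMillsonMoeglin2016Balls, Introduction §1.1] -/
theorem IsImageOfΓ.eq_one_of_smul_eq {Δ : Subgroup U21} (hΔ : IsImageOfΓ D 𝔣 Δ) {δ : Δ} {z : Ball}
    (h : δ • z = z) : δ = 1 := by
  obtain ⟨γ, hγ⟩ := (hΔ δ).1 δ.2
  have h' : D.ballRep 𝔣 γ • z = z := by rw [hγ]; exact h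
  have := D.eq_one_of_smul_eq 𝔣 h'
  subst this
  rw [map_one] at hγ
  exact Subtype.ext hγ.symm

/-- The uniformization is constant on `Δ`-orbits. [folklore] -/
theorem IsImageOfΓ.modelUnif_smul {Δ : Subgroup U21} (hΔ : IsImageOfΓ D 𝔣 Δ) (δ : Δ) (z : Ball) :
    D.modelUnif A 𝔣 (δ • z).1 = D.modelUnif A 𝔣 z.1 := by
  obtain ⟨γ, hγ⟩ := (hΔ δ).1 δ.2
  rw [show (δ • z) = D.ballRep 𝔣 γ • z by rw [hγ]; rfl]
  exact D.modelUnif_smul A 𝔣 γ z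

/-- **A sheet meets each orbit at most once**: if `ψ` is injective on `V`, then for every `z`
there is at most one `δ ∈ Δ` with `δ z ∈ V`. [folklore] -/
theorem IsImageOfΓ.subsingleton_smul_mem {Δ : Subgroup U21} (hΔ : IsImageOfΓ D 𝔣 Δ) {V : Set Ball}
    (hinj : InjOn (fun z : Ball ↦ D.modelUnif A 𝔣 z.1) V) (z : Ball) :
    Set.Subsingleton {δ : Δ | δ • z ∈ V} := by
  intro δ₁ h₁ δ₂ h₂
  have heq : δ₁ • z = δ₂ • z := by
    apply hinj h₁ h₂
    simp only
    rw [hΔ.modelUnif_smul A, hΔ.modelUnif_smul A]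
  have h3 : (δ₂⁻¹ * δ₁) • z = z := by rw [mul_smul, heq, inv_smul_smul]
  have h4 := hΔ.eq_one_of_smul_eq h3
  rw [inv_mul_eq_one] at h4
  exact h4.symm

/-- Pointwise: `Σ_δ 𝟙_{δ⁻¹ V}(z) f(z) = 𝟙_{Δ V}(z) f(z)` when the sheet meets each orbit at most
once. [folklore] -/
theorem IsImageOfΓ.tsum_indicator_smul_preimage {F : Type*} [NormedAddCommGroup F] [NormedSpace ℝ F]
    {Δ : Subgroup U21} (hΔ : IsImageOfΓ D 𝔣 Δ) {V : Set Ball}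
    (hinj : InjOn (fun z : Ball ↦ D.modelUnif A 𝔣 z.1) V) (f : Ball → F) (z : Ball) :
    ∑' δ : Δ, ((fun w ↦ δ • w) ⁻¹' V).indicator f z = (satur Δ V).indicator f z := by
  by_cases hz : z ∈ satur Δ V
  · obtain ⟨δ₀, hδ₀⟩ := hz
    rw [indicator_of_mem (show z ∈ satur Δ V from ⟨δ₀, hδ₀⟩)]
    rw [tsum_eq_single δ₀]
    · exact indicator_of_mem (show z ∈ (fun w ↦ δ₀ • w) ⁻¹' V from hδ₀) f
    · intro δ hδ
      apply indicator_of_notMem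
      intro hmem
      exact hδ (hΔ.subsingleton_smul_mem A hinj z hmem hδ₀)
  · rw [indicator_of_notMem hz]
    have h0 : ∀ δ : Δ, ((fun w ↦ δ • w) ⁻¹' V).indicator f z = 0 := fun δ ↦
      indicator_of_notMem (s := (fun w ↦ δ • w) ⁻¹' V) (a := z) (fun hmem ↦ hz ⟨δ, hmem⟩) f
    simp [h0]

/-- **The unfolding identity.** Let `Δ ≤ U(2,1)` be the image of `Γ`, `𝓕` a measurable fundamental
domain for `Δ` in the ball (Lebesgue measure), `V` a measurable sheet (`ψ` injective on `V`)
contained in a compact set, `k` continuous and `Δ`-invariant, `h` continuous and Jacobian-twisted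
(`h z = det_ℝ J(δ,z) · h(δ z)`). Then `∫_V k h dλ = ∫_𝓕 𝟙_{Δ V} k h dλ`.
[cite: Borel1997, §5.14] -/
theorem setIntegral_sheet_eq_setIntegral_fundamentalDomain
    {Δ : Subgroup U21} (hΔ : IsImageOfΓ D 𝔣 Δ)
    {𝓕 : Set Ball} (h𝓕 : IsFundamentalDomain Δ 𝓕 ballVolume) (h𝓕m : MeasurableSet 𝓕)
    {V C : Set Ball} (hVm : MeasurableSet V) (hC : IsCompact C) (hVC : V ⊆ C)
    (hinj : InjOn (fun z : Ball ↦ D.modelUnif A 𝔣 z.1) V)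
    {k h : Ball → ℂ} (hk : Continuous k) (hh : Continuous h)
    (hkinv : ∀ (δ : Δ) (z : Ball), k (δ • z) = k z)
    (htw : ∀ (δ : Δ) (z : Ball), h z = ((jacCLM (δ : U21) z).det : ℂ) * h (δ • z)) :
    ∫ z in V, k z * h z ∂ballVolume =
      ∫ z in 𝓕, (satur Δ V).indicator (fun z ↦ k z * h z) z ∂ballVolume := by
  haveI : Countable Δ := hΔ.countable
  set f : Ball → ℂ := fun z ↦ k z * h z with hf
  have hfc : Continuous f := hk.mul hh
  -- integrability of `𝟙_V f`
  have hfC : IntegrableOn f C ballVolume := hfc.continuousOn.integrableOn_compact hC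
  have hfV : IntegrableOn f V ballVolume := hfC.mono_set hVC
  have hind : Integrable (V.indicator f) ballVolume := hfV.integrable_indicator hVm
  -- Step 1: `∫_V f = Σ_δ ∫_{δ 𝓕} 𝟙_V f`
  have step1 : ∫ z in V, f z ∂ballVolume = ∑' δ : Δ, ∫ z in δ • 𝓕, V.indicator f z ∂ballVolume := by
    rw [← integral_indicator hVm]
    exact integral_eq_tsum_smul h𝓕 h𝓕m _ hind
  -- Step 2: change of variables in each term and the twist
  have key : ∀ (δ : Δ) (z : Ball),
      ((jacCLM (δ : U21) z).det : ℝ) • V.indicator f (δ • z) =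
        ((fun w ↦ δ • w) ⁻¹' V).indicator f z := by
    intro δ z
    by_cases hz : δ • z ∈ V
    · rw [indicator_of_mem hz, indicator_of_mem (show z ∈ (fun w ↦ δ • w) ⁻¹' V from hz)]
      simp only [hf]
      rw [hkinv δ z, htw δ z, Complex.real_smul]
      ring
    · rw [indicator_of_notMem hz, indicator_of_notMem (show z ∉ (fun w ↦ δ • w) ⁻¹' V from hz),
        smul_zero]
  have step2 : ∀ δ : Δ, ∫ z in δ • 𝓕, V.indicator f z ∂ballVolume =
      ∫ z in 𝓕, ((fun w ↦ δ • w) ⁻¹' V).indicator f z ∂ballVolume := by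
    intro δ
    rw [show (δ • 𝓕 : Set Ball) = (δ : U21) • 𝓕 from rfl,
      setIntegral_smul_eq (δ : U21) h𝓕m (V.indicator f)]
    refine setIntegral_congr_fun h𝓕m fun z _ ↦ ?_
    exact key δ z
  -- Step 3: summability of the norms, by the same computation for `‖f‖`
  have hnorm : ∀ (δ : Δ) (z : Ball),
      ENNReal.ofReal (jacCLM (δ : U21) z).det * ‖V.indicator f (δ • z)‖ₑ =
        ‖((fun w ↦ δ • w) ⁻¹' V).indicator f z‖ₑ := by
    intro δ z
    rw [← key δ z, enorm_smul, Real.enorm_eq_ofReal (det_jacCLM_pos _ z).le]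
  have step3 : ∑' δ : Δ, ∫⁻ z in 𝓕, ‖((fun w ↦ δ • w) ⁻¹' V).indicator f z‖ₑ ∂ballVolume =
      ∫⁻ z, ‖V.indicator f z‖ₑ ∂ballVolume := by
    rw [lintegral_eq_tsum_smul h𝓕 h𝓕m]
    refine tsum_congr fun δ ↦ ?_
    rw [show (δ • 𝓕 : Set Ball) = (δ : U21) • 𝓕 from rfl,
      setLIntegral_smul_eq (δ : U21) h𝓕m fun z ↦ ‖V.indicator f z‖ₑ]
    refine setLIntegral_congr_fun h𝓕m fun z _ ↦ ?_
    exact (hnorm δ z).symm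
  have hsum : ∑' δ : Δ, ∫⁻ z in 𝓕, ‖((fun w ↦ δ • w) ⁻¹' V).indicator f z‖ₑ ∂ballVolume ≠ ∞ := by
    rw [step3]
    exact hind.2.ne
  -- Step 4: interchange sum and integral
  have hmeas : ∀ δ : Δ, AEStronglyMeasurable (((fun w ↦ δ • w) ⁻¹' V).indicator f)
      (ballVolume.restrict 𝓕) := fun δ ↦
    (hfc.aestronglyMeasurable.indicator ((measurable_const_smul (δ : U21)) hVm)).restrict
  have step4 : ∑' δ : Δ, ∫ z in 𝓕, ((fun w ↦ δ • w) ⁻¹' V).indicator f z ∂ballVolume =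
      ∫ z in 𝓕, ∑' δ : Δ, ((fun w ↦ δ • w) ⁻¹' V).indicator f z ∂ballVolume :=
    (integral_tsum hmeas hsum).symm
  rw [step1]
  simp_rw [step2]
  rw [step4]
  refine setIntegral_congr_fun h𝓕m fun z _ ↦ ?_
  exact hΔ.tsum_indicator_smul_preimage A hinj f z

end BallUnfolding

end Literature.AlgebraicGeometry.ShimuraVarieties

end
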